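import Summits.HubbardSuperconductivity.HubbardLadder.ClusterCutBlocks
import HarnessLib

/-!
# Cluster pair-cuts: the integer pair list of cut adv06_it4_s4 (`cut_oct12_adv06oct12it4_s4.json` 3a628d2ac7f03b6c, σ = −99/500)

HONEST FRAMING: ladder R1–R4 with certified numbers; no claim on H/H₀.  Cell pub-hubbard, lane r2-eng-1 (g13).  Kernel-side data of the cut
(`DEN = 10⁶`): the integer pair list `adv06it4P` (one orientation `(i, j, DEN·a_o)` per pair of orbit `o`, sites in the order of
`Oct12Representation`) and `pairsOK 12 adv06it4P` (kernel).  The per-piece kernel certificates `ClusterCutOct12Adv06It4FrameNN` are stated for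
`pairOp adv06it4P`; the identity with the cut's symmetric weight table (`= 2 • pairOp adv06it4P`) belongs with the row assembly.  All statements [folklore].
-/

namespace Summit.HubbardSuperconductivity.HubbardLadder.ClusterCut

open Matrix Literature.MathematicalPhysics.QuantumLattice

/-- The integer pair list of cut adv06_it4_s4: one orientation `(i, j, DEN·a_o)` per pair of orbit `o` (`DEN = 10⁶`; 66 pairs). -/
def adv06it4P : NatPairList :=
  [(0, 1, -2455), (0, 2, 10676), (0, 3, 41616), (0, 4, -6281), (0, 5, -3721), (0, 6, -3721),
   (0, 7, 6770), (0, 8, -13122), (0, 9, -2367), (0, 10, -2904), (0, 11, -754), (1, 2, -3721),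
   (1, 3, -6281), (1, 4, 41616), (1, 5, 10676), (1, 6, -2367), (1, 7, -13122), (1, 8, 6770),
   (1, 9, -3721), (1, 10, -754), (1, 11, -2904), (2, 3, 41616), (2, 4, 6770), (2, 5, -2904),
   (2, 6, -2455), (2, 7, -6281), (2, 8, -13122), (2, 9, -754), (2, 10, -3721), (2, 11, -2367),
   (3, 4, 75911), (3, 5, 6770), (3, 6, -6281), (3, 7, 75911), (3, 8, -23827), (3, 9, -13122),
   (3, 10, 6770), (3, 11, -13122), (4, 5, 41616), (4, 6, -13122), (4, 7, -23827), (4, 8, 75911),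
   (4, 9, -6281), (4, 10, -13122), (4, 11, 6770), (5, 6, -754), (5, 7, -13122), (5, 8, -6281),
   (5, 9, -2455), (5, 10, -2367), (5, 11, -3721), (6, 7, 41616), (6, 8, 6770), (6, 9, -2904),
   (6, 10, 10676), (6, 11, -3721), (7, 8, 75911), (7, 9, 6770), (7, 10, 41616), (7, 11, -6281),
   (8, 9, 41616), (8, 10, -6281), (8, 11, 41616), (9, 10, -3721), (9, 11, 10676), (10, 11, -2455)]

/-- Kernel: in every pair of `adv06it4P` the sites are `< 12` and distinct. -/
theorem adv06it4P_ok : pairsOK 12 adv06it4P = true := by decide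

end Summit.HubbardSuperconductivity.HubbardLadder.ClusterCut
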